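import Mathlib
import Summits.PneNP.PneNP.Statement
import Summits.PneNP.PneNP.Theorems.SoloBlindAnchor
import Literature.Computability.Complexity.CountingHierarchyPH
import Literature.Computability.Complexity.CountingProofs
import Literature.Computability.Complexity.OracleEmptyFP
import Literature.Computability.QuantumComplexity.PermanentHardness
import HarnessLib

/-!
# The counting floor of the summit: `P ≠ PP`, `P ≠ CₖP`, `P ≠ CH`, `P ≠ P^{#P}`, no `#P`-hard function in `FP`

Solo seat `solo-PneNP-blind` (blind mode), companion of §8♭ "THE FLOOR" of the seat's report
(`run/shared/lean/ideation/PneNP/solo-blind/paper/paper.md`, census entry (pp)): the COUNTING rungs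
below the summit. Any proof of `PneNP` proves, in passing, each of

* `P ≠ PP` (`SoloBlind.P_ne_PP_of_pneNP`), witnessed by `SAT ∈ PP ∖ P` (`SoloBlind.SAT_mem_PP`);
* `P ≠ CₖP` for every level `k ≥ 1` of the counting hierarchy and `P ≠ CH`
  (`SoloBlind.P_ne_CkP_succ_of_pneNP`, `SoloBlind.P_ne_CH_of_pneNP`);
* `P ≠ P^{#P}` (`SoloBlind.P_ne_PSharpP_of_pneNP`);
* no `#P`-hard function (Cook reductions, answers in binary) is computable in polynomial time
  (`SoloBlind.sharpPHard_not_mem_FP_of_pneNP`); in particular, granting Valiant's theorem as the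
  tree's named fact `permanent01_isSharpPHardFun`, the `0/1` permanent is not in `FP`
  (`SoloBlind.permanent_not_mem_FP_of_pneNP`).

Each consequence is OPEN in print, and none is known to imply the summit back: the printed
implications run `#SAT ∈ FP ⟹ P = NP` and `P = PP ⟹ P = NP` (Arora–Barak 2009, §17.2–17.4), i.e.
exactly the contrapositives below; whether `P = NP` forces `P = PP` is not known. Everything is
bookkeeping over PROVED tree inclusions: `NP ⊆ PP` (`NP_subset_PP_holds`, Gill 1977 Thm. 6.5),
`PP = C₁P ⊆ CₖP ⊆ CH` (`CkP_one`, `CkP_mono`, `CkP_subset_CH`, Torán 1991), `PP ⊆ P^{#P}`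
(`PP_subset_PSharpP_holds`), `P^{#P} ⊆ P^h` for `#P`-hard `h`
(`PSharpP_subset_PRel_ofFun_of_isSharpPHardFun`) and `h ∈ FP ⟹ P^h ⊆ P`
(`PRel_subset_P_of_mem_FP`), with the seat's anchor `SoloBlind.pneNP_iff_SAT_not_mem_P`.
No new definitions. [cite: AroraBarakCC2009, §17.2, Thm. 17.11, Thm. 17.14] [cite: Gill1977, Thm. 6.5]
[cite: Valiant1979, Thm. 1] [cite: Toran1991, §3]
-/

namespace Summit.PneNP.PneNP.Theorems

open Literature.Computability.Complexity
open Literature.Computability.QuantumComplexity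

/-- `SAT ∈ PP`, from `SAT ∈ NP` and `NP ⊆ PP` (Gill). [cite: Gill1977, Thm. 6.5] -/
theorem SoloBlind.SAT_mem_PP : SAT ∈ PP :=
  NP_subset_PP_holds SAT_mem_NP_holds

/-- **Counting floor, rung 1.** The summit implies `P ≠ PP` (open in print; the known implication is
the converse-contrapositive `P = PP ⟹ P = NP`, Arora–Barak 2009, §17.2.1).
[cite: AroraBarakCC2009, §17.2.1] [cite: Gill1977, Thm. 6.5] -/
theorem SoloBlind.P_ne_PP_of_pneNP (h : PneNP) : Classes.P ≠ PP := by
  intro heq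
  apply SoloBlind.pneNP_iff_SAT_not_mem_P.1 h
  rw [heq]
  exact SoloBlind.SAT_mem_PP

/-- `SAT ∈ CₖP` for every `k ≥ 1` (`PP = C₁P ⊆ CₖP`). [cite: Toran1991, §3] -/
theorem SoloBlind.SAT_mem_CkP_succ (k : ℕ) : SAT ∈ CkP (k + 1) := by
  have h1 : SAT ∈ CkP 1 := by
    rw [CkP_one]
    exact SoloBlind.SAT_mem_PP
  exact CkP_mono (by omega) h1

/-- **Counting floor, every level.** The summit implies `P ≠ CₖP` for every `k ≥ 1`.
[cite: Toran1991, §3] -/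
theorem SoloBlind.P_ne_CkP_succ_of_pneNP (h : PneNP) (k : ℕ) : Classes.P ≠ CkP (k + 1) := by
  intro heq
  apply SoloBlind.pneNP_iff_SAT_not_mem_P.1 h
  rw [heq]
  exact SoloBlind.SAT_mem_CkP_succ k

/-- **Counting floor, the hierarchy.** The summit implies `P ≠ CH`. [cite: Toran1991, §3] -/
theorem SoloBlind.P_ne_CH_of_pneNP (h : PneNP) : Classes.P ≠ CH := by
  intro heq
  apply SoloBlind.pneNP_iff_SAT_not_mem_P.1 h
  rw [heq]
  exact PP_subset_CH SoloBlind.SAT_mem_PP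

/-- `SAT ∈ P^{#P}` (`NP ⊆ PP ⊆ P^{#P}`). [cite: AroraBarakCC2009, §17.2.1] -/
theorem SoloBlind.SAT_mem_PSharpP : SAT ∈ PSharpP :=
  PP_subset_PSharpP_holds SoloBlind.SAT_mem_PP

/-- **Counting floor, oracle form.** The summit implies `P ≠ P^{#P}` (open in print; Arora–Barak
2009, §17.2: "if #SAT ∈ FP then P = NP" is the contrapositive direction). [cite: AroraBarakCC2009, §17.2] -/
theorem SoloBlind.P_ne_PSharpP_of_pneNP (h : PneNP) : Classes.P ≠ PSharpP := by
  intro heq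
  apply SoloBlind.pneNP_iff_SAT_not_mem_P.1 h
  rw [heq]
  exact SoloBlind.SAT_mem_PSharpP

/-- **Unconditionally: a `#P`-hard function in `FP` collapses `P^{#P}` to `P`.** If `h` is
`#P`-hard under Cook reductions (`IsSharpPHardFun h`: `#P ⊆ FP^h`, answers in binary) and its
binary-answer oracle `Oracle.ofFun h = encodeNat ∘ h` is polynomial-time computable, then
`P^{#P} ⊆ P^h ⊆ P`. [cite: AroraBarakCC2009, Def. 17.5, §3.4 Example 3.6 (2)] -/
theorem SoloBlind.PSharpP_subset_P_of_sharpPHard_mem_FP {h : List Bool → ℕ}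
    (hh : IsSharpPHardFun h) (hFP : Oracle.ofFun h ∈ FP) : PSharpP ⊆ Classes.P :=
  (PSharpP_subset_PRel_ofFun_of_isSharpPHardFun hh).trans (PRel_subset_P_of_mem_FP hFP)

/-- **Counting floor, function form.** The summit implies that NO `#P`-hard function is computable
in polynomial time (as a binary-answer string function). [cite: AroraBarakCC2009, §17.2, Def. 17.5] -/
theorem SoloBlind.sharpPHard_not_mem_FP_of_pneNP (hS : PneNP) {h : List Bool → ℕ}
    (hh : IsSharpPHardFun h) : Oracle.ofFun h ∉ FP := fun hFP =>
  SoloBlind.pneNP_iff_SAT_not_mem_P.1 hS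
    (SoloBlind.PSharpP_subset_P_of_sharpPHard_mem_FP hh hFP SoloBlind.SAT_mem_PSharpP)

/-- **Counting floor, the permanent.** Granting Valiant's theorem in the tree's form (the named fact
`permanent01_isSharpPHardFun`: the `0/1` permanent `per01Fn` is `#P`-hard), the summit implies
`PERM ∉ FP`: the permanent of `0/1` matrices (binary answer) is not polynomial-time computable —
open in print; the explicit record toward it is `PERM ∉ DLOGTIME`-uniform `TC⁰` (Allender 1999).
[cite: Valiant1979, Thm. 1] [cite: AroraBarakCC2009, Thm. 17.11] -/
theorem SoloBlind.permanent_not_mem_FP_of_pneNP (hVal : permanent01_isSharpPHardFun) (hS : PneNP) :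
    Oracle.ofFun per01Fn ∉ FP :=
  SoloBlind.sharpPHard_not_mem_FP_of_pneNP hS hVal

/-- **The counting floor, bundled.** `PneNP → P ≠ PP ∧ P ≠ CH ∧ P ≠ P^{#P} ∧ (∀ h #P-hard, h ∉ FP)`.
[cite: AroraBarakCC2009, §17.2] [cite: Gill1977, Thm. 6.5] -/
theorem SoloBlind.countingFloor_of_pneNP (hS : PneNP) :
    Classes.P ≠ PP ∧ Classes.P ≠ CH ∧ Classes.P ≠ PSharpP ∧
      ∀ h : List Bool → ℕ, IsSharpPHardFun h → Oracle.ofFun h ∉ FP :=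
  ⟨SoloBlind.P_ne_PP_of_pneNP hS, SoloBlind.P_ne_CH_of_pneNP hS, SoloBlind.P_ne_PSharpP_of_pneNP hS,
    fun _ hh => SoloBlind.sharpPHard_not_mem_FP_of_pneNP hS hh⟩

/-- **Contrapositive packaging (the direction that IS in print).** A polynomial-time algorithm for
any one `#P`-hard function — e.g. the `0/1` permanent, granting Valiant's theorem — refutes the
summit: `P^{#P} = P ⊇ NP`. [cite: AroraBarakCC2009, §17.2 ("if #SAT ∈ FP then P = NP")] -/
theorem SoloBlind.not_pneNP_of_sharpPHard_mem_FP {h : List Bool → ℕ} (hh : IsSharpPHardFun h)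
    (hFP : Oracle.ofFun h ∈ FP) : ¬ PneNP := fun hS =>
  SoloBlind.sharpPHard_not_mem_FP_of_pneNP hS hh hFP

end Summit.PneNP.PneNP.Theorems
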